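import Mathlib
import Summits.Ventures.PercRepro2.Defs
import Summits.Ventures.PercRepro2.Harris
import Summits.Ventures.PercRepro2.Graph
import Summits.Ventures.PercRepro2.Events
import Summits.Ventures.PercRepro2.TReduction
import Summits.Ventures.PercRepro2.TReductionBase
import Summits.Ventures.PercRepro2.AntipodalHarris
import Summits.Ventures.PercRepro2.TMonoH
import Summits.Ventures.PercRepro2.TStar

/-!
# The star reduction needs (STAR) only for classes that miss the root (blind cell PercRepro2, mine-a g44)

`TStar.kform_nonneg_of_star` reduces (T) to the star hypothesis (STAR): the antipodal sums
`K_D(p)` are nonnegative once `D` touches the class of `h` and every other boundary edge of the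
class is pinned closed.  This file disposes of the classes that contain the root `s` of the
cluster events: there `Q = {h ∈ C_s}` holds on every configuration the sum sees, and `K_D(p)` is a
mixture of antipodal Harris sums.  `kform_nonneg_of_base_of_invariant` is the free-edge induction
of `TReduction.kform_nonneg_of_base` restricted to an invariant of `(D, p)` preserved by the three
pinning moves; `kform_nonneg_of_root_mem_hClass` applies it to the invariant «`s` lies in the class
of `h`», whose base cases are the Harris sums of `AntipodalHarris.lean` (the hit indicator is the
constant `1` on every base configuration, since the pinned-open edges are open there).
`t_cluster_of_star_root` restates (T_h): (STAR) is only needed when the class of `h` misses the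
root.  No instance, no notation.
-/

namespace Summit.Ventures.PercRepro2

namespace TReduction

open Finset

section Root

variable {E : Type*} [Fintype E] [DecidableEq E] {R : Type*} [Field R] [LinearOrder R]
  [IsStrictOrderedRing R] {V : Type*}

/-- **The free-edge induction with an invariant.** If a predicate on `(D, p)` is preserved by
pinning a free edge closed, pinning it open and moving it into `D`, and every base case
satisfying it is nonnegative, then every `K_D(p)` satisfying it is nonnegative. -/
theorem kform_nonneg_of_base_of_invariant (Q U e : Set (Config E))
    (Inv : Finset E → (E → R) → Prop)
    (hinv0 : ∀ (D : Finset E) (p : E → R) (g : E), g ∈ freeEdges D p → Inv D p →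
      Inv D (Function.update p g 0))
    (hinv1 : ∀ (D : Finset E) (p : E → R) (g : E), g ∈ freeEdges D p → Inv D p →
      Inv D (Function.update p g 1))
    (hinvD : ∀ (D : Finset E) (p : E → R) (g : E), g ∈ freeEdges D p → Inv D p →
      Inv (insert g D) p)
    (hbase : ∀ (D : Finset E) (a : E → R), IsProbVec a → (∀ x, x ∉ D → a x = 0 ∨ a x = 1) →
      Inv D a → 0 ≤ kform Q U e D a) :
    ∀ (D : Finset E) (p : E → R), IsProbVec p → Inv D p → 0 ≤ kform Q U e D p := by
  suffices h : ∀ n : ℕ, ∀ (D : Finset E) (p : E → R), IsProbVec p → Inv D p →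
      (freeEdges D p).card = n → 0 ≤ kform Q U e D p from fun D p hp hI => h _ D p hp hI rfl
  intro n
  induction n with
  | zero =>
    intro D p hp hI hn
    apply hbase D p hp _ hI
    intro x hx
    by_cases h0 : p x = 0
    · exact Or.inl h0
    by_cases h1 : p x = 1
    · exact Or.inr h1
    exfalso
    have hmem : x ∈ freeEdges D p := mem_freeEdges.2 ⟨hx, h0, h1⟩
    rw [card_eq_zero] at hn
    rw [hn] at hmem
    exact notMem_empty x hmem
  | succ n ih =>
    intro D p hp hI hn
    obtain ⟨g, hg⟩ : (freeEdges D p).Nonempty := by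
      rw [← card_pos, hn]; exact Nat.succ_pos n
    have hgD : g ∉ D := (mem_freeEdges.1 hg).1
    have hcard : ((freeEdges D p).erase g).card = n := by
      rw [card_erase_of_mem hg, hn]; rfl
    have h0 : 0 ≤ kform Q U e D (Function.update p g 0) :=
      ih D _ (hp.update g le_rfl zero_le_one) (hinv0 D p g hg hI)
        (by rw [freeEdges_update D p hg (Or.inl rfl), hcard])
    have h1 : 0 ≤ kform Q U e D (Function.update p g 1) :=
      ih D _ (hp.update g zero_le_one le_rfl) (hinv1 D p g hg hI)
        (by rw [freeEdges_update D p hg (Or.inr rfl), hcard])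
    have h2 : 0 ≤ kform Q U e (insert g D) p :=
      ih (insert g D) p hp (hinvD D p g hg hI) (by rw [freeEdges_insert D p g, hcard])
    rw [kform_pin Q U e hgD p]
    have hpg0 : 0 ≤ p g := hp.nonneg g
    have hpg1 : 0 ≤ 1 - p g := sub_nonneg.2 (hp.le_one g)
    exact add_nonneg (add_nonneg (mul_nonneg (sq_nonneg _) h0) (mul_nonneg (sq_nonneg _) h1))
      (mul_nonneg (mul_nonneg hpg0 hpg1) h2)

/-- **Classes containing the root are harmless**: for the cluster events `Q = {h ∈ C_s}`,
`U = {C_s ∈ 𝓤}`, `e = {C_s ∈ 𝓥}` (`𝓤 𝓥` up-sets), `K_D(p) ≥ 0` whenever the root `s` lies in the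
class of `h` under `(D, p)`. -/
theorem kform_nonneg_of_root_mem_hClass (ends : E → Sym2 V) (s h : V) {𝓤 𝓥 : Set (Set V)}
    (h𝓤 : IsUpperSet 𝓤) (h𝓥 : IsUpperSet 𝓥) :
    ∀ (D : Finset E) (p : E → R), IsProbVec p → s ∈ hClass ends p D h →
      0 ≤ kform (clusterInEvent ends s {T : Set V | h ∈ T}) (clusterInEvent ends s 𝓤)
        (clusterInEvent ends s 𝓥) D p := by
  refine kform_nonneg_of_base_of_invariant _ _ _ (fun D p => s ∈ hClass ends p D h) ?_ ?_ ?_ ?_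
  · intro D p g hg hs
    show s ∈ cluster ends (pinnedOpenConfig (Function.update p g 0) D) h
    rw [pinnedOpenConfig_update_zero p D (mem_freeEdges.1 hg).2.2]
    exact hs
  · intro D p g _ hs
    exact cluster_mono (pinnedOpenConfig_le_update_one p D g) h hs
  · intro D p g hg hs
    show s ∈ cluster ends (pinnedOpenConfig p (insert g D)) h
    rw [pinnedOpenConfig_insert p D (mem_freeEdges.1 hg).2.2]
    exact hs
  · intro D a ha0 ha hs
    rw [kform_eq_antipodal_sum _ _ _ ha]
    have hQ : ∀ σ ∈ suppOn D,
        (clusterInEvent ends s {T : Set V | h ∈ T}).indicator (fun _ => (1 : R))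
          (baseConfig a D σ) = 1 := by
      intro σ _
      apply Set.indicator_of_mem
      show h ∈ cluster ends (baseConfig a D σ) s
      exact conn_symm (conn_mono (pinnedOpenConfig_le_baseConfig a D σ) hs)
    have hconst : ∀ σ ∈ suppOn D,
        (clusterInEvent ends s {T : Set V | h ∈ T}).indicator (fun _ => (1 : R))
            (baseConfig a D σ)
          * ((clusterInEvent ends s 𝓤).indicator (fun _ => (1 : R)) (baseConfig a D σ)
              - (clusterInEvent ends s 𝓤).indicator (fun _ => (1 : R))
                  (baseConfig a D fun x => !σ x))
          * ((clusterInEvent ends s 𝓥).indicator (fun _ => (1 : R)) (baseConfig a D σ)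
              - (clusterInEvent ends s 𝓥).indicator (fun _ => (1 : R))
                  (baseConfig a D fun x => !σ x)) =
        ((clusterInEvent ends s 𝓤).indicator (fun _ => (1 : R)) (baseConfig a D σ)
              - (clusterInEvent ends s 𝓤).indicator (fun _ => (1 : R))
                  (baseConfig a D fun x => !σ x))
          * ((clusterInEvent ends s 𝓥).indicator (fun _ => (1 : R)) (baseConfig a D σ)
              - (clusterInEvent ends s 𝓥).indicator (fun _ => (1 : R))
                  (baseConfig a D fun x => !σ x)) := by
      intro σ hσ
      rw [hQ σ hσ, one_mul]
    rw [sum_congr rfl hconst]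
    exact antipodal_sum_nonneg_of_isUpperSet (isUpperSet_clusterInEvent ends s h𝓤)
      (isUpperSet_clusterInEvent ends s h𝓥) ha0 ha

/-- **(T_h) from (STAR) on the classes that miss the root**: for admissible weights, a root `s`,
a vertex `h` and up-sets `𝓤 𝓥`, (T_h) in the shape of `TFKG.t_of_isForest` follows from (STAR)
for the classes of `h` not containing `s`. -/
theorem t_cluster_of_star_root (p : E → R) (hp : IsProbVec p) (ends : E → Sym2 V) (s h : V)
    {𝓤 𝓥 : Set (Set V)} (h𝓤 : IsUpperSet 𝓤) (h𝓥 : IsUpperSet 𝓥)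
    (hstar : ∀ (D : Finset E) (a : E → R), IsProbVec a → s ∉ hClass ends a D h →
      (∀ x ∈ D, x ∈ touches ends (hClass ends a D h)) →
      (∀ x, x ∉ D → x ∈ boundary ends (hClass ends a D h) → a x = 0) →
      0 ≤ kform (clusterInEvent ends s {T : Set V | h ∈ T}) (clusterInEvent ends s 𝓤)
        (clusterInEvent ends s 𝓥) D a) :
    let Q := clusterInEvent ends s {T : Set V | h ∈ T}
    let U := clusterInEvent ends s 𝓤
    let e := clusterInEvent ends s 𝓥
    prob p (Q ∩ U) * prob p e + prob p U * prob p (Q ∩ e) ≤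
      prob p (Q ∩ U ∩ e) + prob p Q * prob p (U ∩ e) := by
  intro Q U e
  apply t_cluster_of_star p hp ends s h 𝓤 𝓥
  intro D a ha0 hD hb
  by_cases hs : s ∈ hClass ends a D h
  · exact kform_nonneg_of_root_mem_hClass ends s h h𝓤 h𝓥 D a ha0 hs
  · exact hstar D a ha0 hs hD hb

end Root

end TReduction

end Summit.Ventures.PercRepro2
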